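import Summits.HodgeConjecture.HodgeConjecture.Theorems.Q8BireflectionGroupDensityAmbient
import HarnessLib

/-!
# Route `Q8SymplecticPowers`, crux K1Q — BIREFLECTION RECOGNITION: the local-monodromy output of a d6 meridian (two τ-rotated
# vanishing planes `V₁ ⊥ V₂`, `γ = τ` on `V₁`, `γ = τ⁻¹` on `V₂`, `γ ≡ 1 mod V₁ ⊕ V₂`) IS an `(i, −i)`-bireflection in the currency of
# stub S5 `stub_monodromyBireflectionQ` (the «GROUP-THEORY COROLLARY» of memo ROUTE-P3v27 §1b, tree side of LOC6)

Support file for crux K1Q (stmt-HodgeConjecture-24190; `--supports … --as helper`). Prover seat `hodge-nonav-prover-Ax` (g17). The geometric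
bricks L6-1…L6-6 of the route owner's LOC6 plan deliver, at a base point, a monodromy element `γ` and RATIONAL planes `V₁, V₂ ≤ H`
(`H = H²(X_s; ℚ)`): `γ x − x ∈ V₁ ⊔ V₂`, `A V_k ⊆ V_k`, `A² = −1` on `V_k`, `γ|_{V₁} = A`, `γ|_{V₂} = A⁻¹ = −A`, `B V₁ ⊆ V₂`, `B V₂ ⊆ V₁`,
`B² = −1`, `AB = −BA` on the planes, `V₁ ⊥ V₂`, `Q|_{V_k}` non-degenerate, `dim V_k = 2` (`A = τ*`, `B = j*`, `Q = tr ∘ cup`). This file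
converts that into the `h_bi` clause of BQ-CORE ∕ S5 on `L ⊗ H` (`L ⊇ K` a field with `i² = −1`, e.g. `ℂ`): eigenvectors `ℓp ∈ V₁ ⊗ L`,
`ℓm ∈ V₂ ⊗ L` of `A_L` for `i` with `Q_L(ℓp, B_L ℓm) ≠ 0`, `γ_L ℓp = i ℓp`, `γ_L ℓm = −i ℓm`, and `γ_L x = x` for every `i`-eigenvector `x`
orthogonal to `B ℓp, B ℓm`.
* §1 base-change transport for submodules: agreement ∕ invariance ∕ orthogonality ∕ non-degeneracy ∕ sums ∕ dimension pass from `V ≤ H`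
  to `V.baseChange L ≤ L ⊗ H`.
* §2 **`exists_bireflection_datum_of_localMonodromy`**. PROOF: eigenlines of `A_L` in the non-degenerate plane `V_{k,L}` are isotropic
  and one-dimensional; `ℓp := (A + i) u`, `ℓm := (A + i) u'`; `Q(ℓp, Bℓm) ≠ 0` since `Bℓm` spans the other eigenline of `V_{1,L}`; for an
  `i`-eigenvector `x ⊥ Bℓp, Bℓm`: `γx − x ∈ (V₁ ⊔ V₂)_L` is an `i`-eigenvector (`γ` commutes with `A`), hence `= αℓp + βℓm`, and testing
  the isometry `γ` against `Bℓm ∈ V₁` (`γ Bℓm = −i Bℓm`) and `Bℓp ∈ V₂` (`γ Bℓp = i Bℓp`) gives `α = β = 0`.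
HONEST FRAMING: linear algebra only (axioms standard, no named fact); the geometric bricks L6-1…L6-6 (that such `γ, V₁, V₂` exist in the
monodromy of the quaternionic quartic family) are NOT touched; K1Q ∕ HC NOT proved; item 24190 OPEN.
-/

noncomputable section

set_option linter.dupNamespace false

namespace Summit.HodgeConjecture.HodgeConjecture.Theorems.Q8BireflectionRecognition

open Module Summit.HodgeConjecture.HodgeConjecture.Theorems.Q8BireflectionGroupDensityAmbient
open Summit.HodgeConjecture.HodgeConjecture.Theorems.Q8QuaternionicTransvectionDensity
open LinearMap (BilinForm)
open scoped TensorProduct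

/-! ### §1 Base-change transport for submodules -/

section Transport

variable {K : Type*} [Field K] {L : Type*} [Field L] [Algebra K L] {H : Type*} [AddCommGroup H] [Module K H]

/-- Two maps agreeing on `V` have base changes agreeing on `V.baseChange L`. -/
theorem baseChange_eqOn (V : Submodule K H) {f g : H →ₗ[K] H} (h : ∀ x ∈ V, f x = g x) :
    ∀ y ∈ V.baseChange L, f.baseChange L y = g.baseChange L y := by
  intro y hy
  obtain ⟨u, rfl⟩ := (mem_baseChange_iff_exists V).1 hy
  have hc : f ∘ₗ V.subtype = g ∘ₗ V.subtype := LinearMap.ext fun x => h x x.2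
  rw [← LinearMap.comp_apply, ← LinearMap.baseChange_comp, hc, LinearMap.baseChange_comp, LinearMap.comp_apply]

/-- If `f(V) ⊆ V'` then `f_L(V.baseChange L) ⊆ V'.baseChange L`. -/
theorem baseChange_mapsTo (V V' : Submodule K H) {f : H →ₗ[K] H} (h : ∀ x ∈ V, f x ∈ V') :
    ∀ y ∈ V.baseChange L, f.baseChange L y ∈ V'.baseChange L := by
  intro y hy
  obtain ⟨u, rfl⟩ := (mem_baseChange_iff_exists V).1 hy
  let η : V →ₗ[K] V' := LinearMap.codRestrict V' (f ∘ₗ V.subtype) fun x => h x x.2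
  have hc : f ∘ₗ V.subtype = V'.subtype ∘ₗ η := LinearMap.ext fun x => rfl
  rw [← LinearMap.comp_apply, ← LinearMap.baseChange_comp, hc, LinearMap.baseChange_comp, LinearMap.comp_apply]
  exact (mem_baseChange_iff_exists V').2 ⟨_, rfl⟩

/-- If `f(H) ⊆ V` then `f_L(L ⊗ H) ⊆ V.baseChange L`. -/
theorem baseChange_mem_of_forall_mem (V : Submodule K H) {f : H →ₗ[K] H} (h : ∀ x, f x ∈ V) (y : L ⊗[K] H) :
    f.baseChange L y ∈ V.baseChange L := by
  have h' := baseChange_mapsTo (L := L) ⊤ V (f := f) (fun x _ => h x) y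
  rw [Submodule.baseChange_top] at h'
  exact h' Submodule.mem_top

/-- Orthogonality passes to the base change. -/
theorem baseChange_orthogonal (Q : BilinForm K H) (V₁ V₂ : Submodule K H) (h : ∀ x ∈ V₁, ∀ y ∈ V₂, Q x y = 0) :
    ∀ x ∈ V₁.baseChange L, ∀ y ∈ V₂.baseChange L, Q.baseChange L x y = 0 := by
  intro x hx y hy
  obtain ⟨u, rfl⟩ := (mem_baseChange_iff_exists V₁).1 hx
  obtain ⟨u', rfl⟩ := (mem_baseChange_iff_exists V₂).1 hy
  clear hx hy
  induction u using TensorProduct.induction_on with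
  | zero => simp
  | tmul c v =>
    induction u' using TensorProduct.induction_on with
    | zero => simp
    | tmul c' v' =>
      rw [LinearMap.baseChange_tmul, LinearMap.baseChange_tmul, LinearMap.BilinForm.baseChange_tmul, Submodule.subtype_apply,
        Submodule.subtype_apply, h _ v.2 _ v'.2, zero_smul]
    | add a b ha hb => rw [map_add, map_add, ha, hb, add_zero]
  | add a b ha hb => rw [map_add, map_add, LinearMap.add_apply, ha, hb, add_zero]

/-- Non-degeneracy of `Q|_V` (for symmetric `Q`) passes to `Q_L|_{V.baseChange L}`. -/
theorem baseChange_separating [FiniteDimensional K H] (Q : BilinForm K H) (hQs : ∀ x y, Q x y = Q y x) (V : Submodule K H)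
    (hnd : ∀ x ∈ V, (∀ y ∈ V, Q x y = 0) → x = 0) :
    ∀ x ∈ V.baseChange L, (∀ y ∈ V.baseChange L, Q.baseChange L x y = 0) → x = 0 := by
  intro x hx hxy
  obtain ⟨u, rfl⟩ := (mem_baseChange_iff_exists V).1 hx
  set QV : BilinForm K V := Q.compl₁₂ V.subtype V.subtype with hQV
  have hQVn : QV.Nondegenerate := by
    refine ⟨fun a ha => Subtype.ext (hnd a a.2 fun y hy => ha ⟨y, hy⟩), fun a ha => Subtype.ext (hnd a a.2 fun y hy => ?_)⟩
    rw [hQs]; exact ha ⟨y, hy⟩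
  have hQVL := Literature.Algebra.Lie.KillingBaseChange.nondegenerate_baseChange (K := L) hQVn
  have hu : u = 0 := hQVL.1 u fun u' => by
    rw [hQV, baseChange_compl₁₂_subtype]
    exact hxy _ ((mem_baseChange_iff_exists V).2 ⟨u', rfl⟩)
  rw [hu, map_zero]

/-- `(V₁ ⊔ V₂).baseChange L ≤ V₁.baseChange L ⊔ V₂.baseChange L`. -/
theorem baseChange_sup_le (V₁ V₂ : Submodule K H) :
    (V₁ ⊔ V₂).baseChange L ≤ V₁.baseChange L ⊔ V₂.baseChange L := by
  rw [Submodule.baseChange_eq_span, Submodule.span_le]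
  rintro _ ⟨x, hx, rfl⟩
  obtain ⟨v₁, h₁, v₂, h₂, rfl⟩ := Submodule.mem_sup.1 hx
  rw [map_add]
  exact Submodule.add_mem_sup (Submodule.tmul_mem_baseChange_of_mem 1 h₁) (Submodule.tmul_mem_baseChange_of_mem 1 h₂)

/-- `dim_L V.baseChange L = dim_K V`. -/
theorem finrank_baseChange_eq [FiniteDimensional K H] (V : Submodule K H) :
    finrank L (V.baseChange L) = finrank K V := by
  rw [← (Submodule.toBaseChange.toLinearEquiv L V).finrank_eq, Module.finrank_baseChange]

end Transport

/-! ### §2 The recognition theorem -/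

section Recognition

variable {K : Type*} [Field K] {L : Type*} [Field L] [CharZero L] [Algebra K L] {H : Type*} [AddCommGroup H] [Module K H]
  [FiniteDimensional K H]

/-- In a non-degenerate plane on which the isometry `A` squares to `−1`, the `μ`-eigenvectors (`μ² = −1`) form a line: any two are
proportional (two independent ones would make the whole plane `μ`-isotropic, i.e. `Q = 0` on it). Local tool over `L`. -/
theorem exists_smul_of_eigen_of_plane {Q : BilinForm L (L ⊗[K] H)} {A : L ⊗[K] H →ₗ[L] L ⊗[K] H}
    (haQ : ∀ x y, Q (A x) (A y) = Q x y) (P : Submodule L (L ⊗[K] H)) (hP2 : finrank L P = 2)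
    (hnd : ∀ x ∈ P, (∀ y ∈ P, Q x y = 0) → x = 0) {μ : L} (hμ : μ * μ = -1) {w : L ⊗[K] H} (hwP : w ∈ P) (hw0 : w ≠ 0)
    (hw : A w = μ • w) {y : L ⊗[K] H} (hyP : y ∈ P) (hy : A y = μ • y) : ∃ c : L, y = c • w := by
  -- isotropy of `μ`-eigenvectors
  have hiso : ∀ p q, A p = μ • p → A q = μ • q → Q p q = 0 := fun p q hp hq => by
    have h := haQ p q
    rw [hp, hq] at h
    simp only [map_smul, LinearMap.smul_apply, smul_eq_mul] at h
    rw [← mul_assoc, hμ] at h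
    have h2 : (2 : L) * Q p q = 0 := by linear_combination -h
    exact (mul_eq_zero.1 h2).resolve_left two_ne_zero
  by_contra hne
  push Not at hne
  -- `w, y` independent, hence they span the plane `P`
  have hli : LinearIndependent L ![w, y] := by
    refine LinearIndependent.pair_iff.2 fun s t hst => ?_
    by_cases ht : t = 0
    · subst ht
      simp only [zero_smul, add_zero, smul_eq_zero] at hst
      exact ⟨hst.resolve_right hw0, rfl⟩
    · exfalso
      apply hne (-(t⁻¹ * s))
      have : t • y = -(s • w) := eq_neg_of_add_eq_zero_right hst
      calc y = t⁻¹ • (t • y) := by rw [smul_smul, inv_mul_cancel₀ ht, one_smul]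
        _ = -(t⁻¹ * s) • w := by rw [this, smul_neg, smul_smul]; exact (neg_smul _ _).symm
  have hspan : Submodule.span L (Set.range ![w, y]) = P := by
    apply Submodule.eq_of_le_of_finrank_eq
    · rw [Submodule.span_le]
      rintro _ ⟨k, rfl⟩
      fin_cases k
      · exact hwP
      · exact hyP
    · rw [finrank_span_eq_card hli, hP2]; simp
  -- every `z ∈ P` is a `μ`-eigenvector, so `Q|_P = 0`, so `w = 0`
  have hall : ∀ z ∈ P, A z = μ • z := by
    intro z hz
    rw [← hspan, Matrix.range_cons, Matrix.range_cons, Matrix.range_empty, Set.union_empty, Set.union_singleton,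
      Submodule.mem_span_pair] at hz
    obtain ⟨a, b, rfl⟩ := hz
    rw [map_add, map_smul, map_smul, hw, hy, smul_add, smul_comm μ a, smul_comm μ b]
  exact hw0 (hnd w hwP fun z hz => hiso w z hw (hall z hz))

/-- **BIREFLECTION RECOGNITION** (the tree side of LOC6 ∕ stub S5). `K → L` fields, `char L = 0`, `i ∈ L`, `i² = −1`; `H` a finite-dimensional
`K`-space with a symmetric form `Q`; `A, B ∈ End_K H` `Q`-isometries; `γ ∈ GL_K(H)` a `Q`-isometry commuting with `A`; planes `V₁, V₂ ≤ H`
(`dim = 2`) with `A V_k ⊆ V_k`, `A² = −1` on `V_k`, `B V₁ ⊆ V₂`, `B V₂ ⊆ V₁`, `B² = −1` and `AB = −BA` on `V₁, V₂`, `V₁ ⊥ V₂`, `Q|_{V_k}`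
non-degenerate; LOCAL MONODROMY SHAPE: `γ x − x ∈ V₁ ⊔ V₂` for all `x`, `γ = A` on `V₁`, `γ = −A` (`= A⁻¹`) on `V₂`. Then for every `W ≥ V₁ ⊔ V₂`:
there are `ℓp, ℓm ∈ W.baseChange L`, `i`-eigenvectors of `A_L`, with `Q_L(ℓp, B_L ℓm) ≠ 0`, `γ_L ℓp = i ℓp`, `γ_L ℓm = −i ℓm`, and
`γ_L x = x` for every `i`-eigenvector `x ∈ W.baseChange L` with `Q_L(x, B_L ℓp) = Q_L(x, B_L ℓm) = 0` — verbatim the `h_bi` clause of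
stub S5 ∕ `mem_glIdentityComponent_restrict_of_bireflection` (with `L = ℂ`, `i = Complex.I`). -/
theorem exists_bireflection_datum_of_localMonodromy {Q : BilinForm K H} (hQs : ∀ x y, Q x y = Q y x) {A B : H →ₗ[K] H}
    (haQ : ∀ x y, Q (A x) (A y) = Q x y) (hQb : ∀ x y, Q (B x) (B y) = Q x y) {γ : H ≃ₗ[K] H} (hγA : ∀ x, γ (A x) = A (γ x))
    (hγQ : ∀ x y, Q (γ x) (γ y) = Q x y) (V₁ V₂ W : Submodule K H) (hV₁W : V₁ ≤ W) (hV₂W : V₂ ≤ W)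
    (hdim₁ : finrank K V₁ = 2) (hdim₂ : finrank K V₂ = 2) (hAV₁ : ∀ x ∈ V₁, A x ∈ V₁) (hAV₂ : ∀ x ∈ V₂, A x ∈ V₂)
    (haa₁ : ∀ x ∈ V₁, A (A x) = -x) (haa₂ : ∀ x ∈ V₂, A (A x) = -x) (hBV₁ : ∀ x ∈ V₁, B x ∈ V₂) (hBV₂ : ∀ x ∈ V₂, B x ∈ V₁)
    (hbb₁ : ∀ x ∈ V₁, B (B x) = -x) (hbb₂ : ∀ x ∈ V₂, B (B x) = -x) (hab₁ : ∀ x ∈ V₁, A (B x) = -B (A x))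
    (hab₂ : ∀ x ∈ V₂, A (B x) = -B (A x)) (horth : ∀ x ∈ V₁, ∀ y ∈ V₂, Q x y = 0)
    (hnd₁ : ∀ x ∈ V₁, (∀ y ∈ V₁, Q x y = 0) → x = 0) (hnd₂ : ∀ x ∈ V₂, (∀ y ∈ V₂, Q x y = 0) → x = 0)
    (hγV : ∀ x, γ x - x ∈ V₁ ⊔ V₂) (hγ₁ : ∀ x ∈ V₁, γ x = A x) (hγ₂ : ∀ x ∈ V₂, γ x = -A x) {i : L} (hi : i * i = -1) :
    ∃ ℓp ℓm : L ⊗[K] H, ℓp ∈ W.baseChange L ∧ ℓm ∈ W.baseChange L ∧ A.baseChange L ℓp = i • ℓp ∧ A.baseChange L ℓm = i • ℓm ∧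
      (Q.baseChange L) ℓp (B.baseChange L ℓm) ≠ 0 ∧ (γ.toLinearMap.baseChange L) ℓp = i • ℓp ∧
      (γ.toLinearMap.baseChange L) ℓm = (-i) • ℓm ∧
      ∀ x ∈ W.baseChange L, A.baseChange L x = i • x → (Q.baseChange L) x (B.baseChange L ℓp) = 0 →
        (Q.baseChange L) x (B.baseChange L ℓm) = 0 → (γ.toLinearMap.baseChange L) x = x := by
  -- ### notation and the transported hypotheses
  set Qc := Q.baseChange L with hQc
  set Ac := A.baseChange L with hAc
  set Bc := B.baseChange L with hBc
  set γc := (γ : H →ₗ[K] H).baseChange L with hγc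
  set V₁c := V₁.baseChange L with hV₁c
  set V₂c := V₂.baseChange L with hV₂c
  have hm1 : ∀ (f : H →ₗ[K] H) (y : L ⊗[K] H), ((-1 : K) • f).baseChange L y = -(f.baseChange L y) := fun f y => by
    rw [LinearMap.baseChange_smul, LinearMap.smul_apply, neg_one_smul]
  have hQcs : ∀ x y, Qc x y = Qc y x := baseChange_symm hQs
  have haQc : ∀ x y, Qc (Ac x) (Ac y) = Qc x y := baseChange_isometry haQ
  have hQbc : ∀ x y, Qc (Bc x) (Bc y) = Qc x y := baseChange_isometry hQb
  have hγQc : ∀ x y, Qc (γc x) (γc y) = Qc x y := baseChange_isometry (f := (γ : H →ₗ[K] H)) hγQ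
  have hγAc : ∀ x, γc (Ac x) = Ac (γc x) := baseChange_comm_apply (f := (γ : H →ₗ[K] H)) (g := A) hγA
  have hA₁c : ∀ y ∈ V₁c, Ac y ∈ V₁c := baseChange_mapsTo V₁ V₁ hAV₁
  have hA₂c : ∀ y ∈ V₂c, Ac y ∈ V₂c := baseChange_mapsTo V₂ V₂ hAV₂
  have hB₁c : ∀ y ∈ V₁c, Bc y ∈ V₂c := baseChange_mapsTo V₁ V₂ hBV₁
  have hB₂c : ∀ y ∈ V₂c, Bc y ∈ V₁c := baseChange_mapsTo V₂ V₁ hBV₂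
  have haa₁c : ∀ y ∈ V₁c, Ac (Ac y) = -y := fun y hy => by
    have h := baseChange_eqOn (L := L) V₁ (f := A ∘ₗ A) (g := (-1 : K) • LinearMap.id) (fun x hx => by simpa using haa₁ x hx) y hy
    rwa [LinearMap.baseChange_comp, LinearMap.comp_apply, hm1, LinearMap.baseChange_id, LinearMap.id_apply] at h
  have haa₂c : ∀ y ∈ V₂c, Ac (Ac y) = -y := fun y hy => by
    have h := baseChange_eqOn (L := L) V₂ (f := A ∘ₗ A) (g := (-1 : K) • LinearMap.id) (fun x hx => by simpa using haa₂ x hx) y hy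
    rwa [LinearMap.baseChange_comp, LinearMap.comp_apply, hm1, LinearMap.baseChange_id, LinearMap.id_apply] at h
  have hbb₁c : ∀ y ∈ V₁c, Bc (Bc y) = -y := fun y hy => by
    have h := baseChange_eqOn (L := L) V₁ (f := B ∘ₗ B) (g := (-1 : K) • LinearMap.id) (fun x hx => by simpa using hbb₁ x hx) y hy
    rwa [LinearMap.baseChange_comp, LinearMap.comp_apply, hm1, LinearMap.baseChange_id, LinearMap.id_apply] at h
  have hbb₂c : ∀ y ∈ V₂c, Bc (Bc y) = -y := fun y hy => by
    have h := baseChange_eqOn (L := L) V₂ (f := B ∘ₗ B) (g := (-1 : K) • LinearMap.id) (fun x hx => by simpa using hbb₂ x hx) y hy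
    rwa [LinearMap.baseChange_comp, LinearMap.comp_apply, hm1, LinearMap.baseChange_id, LinearMap.id_apply] at h
  have hab₁c : ∀ y ∈ V₁c, Ac (Bc y) = -Bc (Ac y) := fun y hy => by
    have h := baseChange_eqOn (L := L) V₁ (f := A ∘ₗ B) (g := (-1 : K) • (B ∘ₗ A)) (fun x hx => by simpa using hab₁ x hx) y hy
    rwa [LinearMap.baseChange_comp, LinearMap.comp_apply, hm1, LinearMap.baseChange_comp, LinearMap.comp_apply] at h
  have hab₂c : ∀ y ∈ V₂c, Ac (Bc y) = -Bc (Ac y) := fun y hy => by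
    have h := baseChange_eqOn (L := L) V₂ (f := A ∘ₗ B) (g := (-1 : K) • (B ∘ₗ A)) (fun x hx => by simpa using hab₂ x hx) y hy
    rwa [LinearMap.baseChange_comp, LinearMap.comp_apply, hm1, LinearMap.baseChange_comp, LinearMap.comp_apply] at h
  have hγ₁c : ∀ y ∈ V₁c, γc y = Ac y := baseChange_eqOn V₁ (fun x hx => by simpa using hγ₁ x hx)
  have hγ₂c : ∀ y ∈ V₂c, γc y = -Ac y := fun y hy => by
    have h := baseChange_eqOn (L := L) V₂ (f := (γ : H →ₗ[K] H)) (g := (-1 : K) • A) (fun x hx => by simpa using hγ₂ x hx) y hy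
    rwa [hm1] at h
  have hγVc : ∀ x, γc x - x ∈ V₁c ⊔ V₂c := fun x => by
    have h := baseChange_mem_of_forall_mem (L := L) (V₁ ⊔ V₂) (f := (γ : H →ₗ[K] H) - LinearMap.id)
      (fun x => by simpa using hγV x) x
    rw [LinearMap.baseChange_sub, LinearMap.sub_apply, LinearMap.baseChange_id, LinearMap.id_apply] at h
    exact baseChange_sup_le V₁ V₂ h
  have horthc : ∀ x ∈ V₁c, ∀ y ∈ V₂c, Qc x y = 0 := baseChange_orthogonal Q V₁ V₂ horth
  have hnd₁c : ∀ x ∈ V₁c, (∀ y ∈ V₁c, Qc x y = 0) → x = 0 := baseChange_separating Q hQs V₁ hnd₁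
  have hnd₂c : ∀ x ∈ V₂c, (∀ y ∈ V₂c, Qc x y = 0) → x = 0 := baseChange_separating Q hQs V₂ hnd₂
  have hdim₁c : finrank L V₁c = 2 := by rw [hV₁c, finrank_baseChange_eq, hdim₁]
  have hdim₂c : finrank L V₂c = 2 := by rw [hV₂c, finrank_baseChange_eq, hdim₂]
  have hi0 : i ≠ 0 := by rintro rfl; norm_num at hi
  -- isotropy of `i`-eigenvectors
  have hiso : ∀ p q, Ac p = i • p → Ac q = i • q → Qc p q = 0 := fun p q hp hq => by
    have h := haQc p q
    rw [hp, hq] at h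
    simp only [map_smul, LinearMap.smul_apply, smul_eq_mul] at h
    rw [← mul_assoc, hi] at h
    have h2 : (2 : L) * Qc p q = 0 := by linear_combination -h
    exact (mul_eq_zero.1 h2).resolve_left two_ne_zero
  -- ### an `i`-eigenvector in each plane
  have hplane : ∀ (P : Submodule L (L ⊗[K] H)), finrank L P = 2 → (∀ y ∈ P, Ac y ∈ P) → (∀ y ∈ P, Ac (Ac y) = -y) →
      (∀ x ∈ P, (∀ y ∈ P, Qc x y = 0) → x = 0) → ∃ ℓ ∈ P, ℓ ≠ 0 ∧ Ac ℓ = i • ℓ := by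
    intro P hP2 hAP haaP hndP
    -- some `u ∈ P` with `(A + i) u ≠ 0`; else `A = −i` on `P` and `Q|_P = 0`
    obtain ⟨u, huP, hu⟩ : ∃ u ∈ P, Ac u + i • u ≠ 0 := by
      by_contra hall
      push Not at hall
      have hneg : ∀ u ∈ P, Ac u = -(i • u) := fun u hu => eq_neg_of_add_eq_zero_left (hall u hu)
      have hP0 : P = ⊥ := by
        rw [eq_bot_iff]
        intro z hz
        rw [Submodule.mem_bot]
        refine hndP z hz fun y hy => ?_
        have h := haQc z y
        rw [hneg z hz, hneg y hy] at h
        simp only [map_neg, map_smul, LinearMap.neg_apply, LinearMap.smul_apply, smul_eq_mul, neg_neg, mul_neg] at h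
        rw [← mul_assoc, hi] at h
        have h2 : (2 : L) * Qc z y = 0 := by linear_combination -h
        exact (mul_eq_zero.1 h2).resolve_left two_ne_zero
      rw [hP0, finrank_bot] at hP2
      exact absurd hP2 (by norm_num)
    refine ⟨Ac u + i • u, P.add_mem (hAP u huP) (P.smul_mem i huP), hu, ?_⟩
    rw [map_add, map_smul, haaP u huP, smul_add, smul_smul, hi]
    module
  obtain ⟨ℓp, hℓp₁, hℓp0, hAℓp⟩ := hplane V₁c hdim₁c hA₁c haa₁c hnd₁c
  obtain ⟨ℓm, hℓm₂, hℓm0, hAℓm⟩ := hplane V₂c hdim₂c hA₂c haa₂c hnd₂c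
  -- `B ℓm` spans the `(−i)`-line of `V₁c`, `B ℓp` that of `V₂c`
  have hBℓm₁ : Bc ℓm ∈ V₁c := hB₂c ℓm hℓm₂
  have hBℓp₂ : Bc ℓp ∈ V₂c := hB₁c ℓp hℓp₁
  have hABℓm : Ac (Bc ℓm) = (-i) • Bc ℓm := by rw [hab₂c ℓm hℓm₂, hAℓm, map_smul]; exact (neg_smul _ _).symm
  have hABℓp : Ac (Bc ℓp) = (-i) • Bc ℓp := by rw [hab₁c ℓp hℓp₁, hAℓp, map_smul]; exact (neg_smul _ _).symm
  have hBℓm0 : Bc ℓm ≠ 0 := fun h => hℓm0 (by have := hbb₂c ℓm hℓm₂; rw [h, map_zero] at this; exact neg_eq_zero.1 this.symm)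
  have hBℓp0 : Bc ℓp ≠ 0 := fun h => hℓp0 (by have := hbb₁c ℓp hℓp₁; rw [h, map_zero] at this; exact neg_eq_zero.1 this.symm)
  have hii : (-i) * (-i) = -1 := by rw [neg_mul_neg, hi]
  -- ### the pairing `Q(ℓp, B ℓm) ≠ 0`
  have hpair : Qc ℓp (Bc ℓm) ≠ 0 := by
    intro h0
    apply hℓp0
    refine hnd₁c ℓp hℓp₁ fun y hy => ?_
    -- `2i y = (A + i) y − (A − i) y`, the two summands in the two eigenlines of `V₁c`
    have hp : Ac (Ac y + i • y) = i • (Ac y + i • y) := by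
      rw [map_add, map_smul, haa₁c y hy, smul_add, smul_smul, hi]
      module
    have hm : Ac (Ac y - i • y) = (-i) • (Ac y - i • y) := by
      rw [map_sub, map_smul, haa₁c y hy, smul_sub, smul_smul, show (-i) * i = 1 by rw [neg_mul, hi, neg_neg]]
      module
    obtain ⟨c, hc⟩ := exists_smul_of_eigen_of_plane haQc V₁c hdim₁c hnd₁c hii hBℓm₁ hBℓm0 hABℓm
      (V₁c.sub_mem (hA₁c y hy) (V₁c.smul_mem i hy)) hm
    have h1 : Qc ℓp (Ac y + i • y) = 0 := hiso _ _ hAℓp hp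
    have h2 : Qc ℓp (Ac y - i • y) = 0 := by rw [hc, map_smul, smul_eq_mul, h0, mul_zero]
    have h3 : (2 * i) • y = (Ac y + i • y) - (Ac y - i • y) := by rw [mul_smul, two_smul]; abel
    have h4 : Qc ℓp ((2 * i) • y) = 0 := by rw [h3, map_sub, h1, h2, sub_zero]
    rw [map_smul, smul_eq_mul] at h4
    exact (mul_eq_zero.1 h4).resolve_left (mul_ne_zero two_ne_zero hi0)
  have hpair' : Qc ℓm (Bc ℓp) ≠ 0 := by
    rw [← hQbc ℓm (Bc ℓp), hbb₁c ℓp hℓp₁, map_neg, hQcs]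
    exact neg_ne_zero.2 hpair
  -- ### assemble
  refine ⟨ℓp, ℓm, Submodule.baseChange_mono L hV₁W hℓp₁, Submodule.baseChange_mono L hV₂W hℓm₂, hAℓp, hAℓm, hpair,
    by rw [hγ₁c ℓp hℓp₁, hAℓp], by rw [hγ₂c ℓm hℓm₂, hAℓm]; exact (neg_smul _ _).symm, ?_⟩
  intro x _ hAx hxp hxm
  -- `d = γx − x` is an `i`-eigenvector in `V₁c ⊕ V₂c`
  obtain ⟨v₁, hv₁, v₂, hv₂, hd⟩ := Submodule.mem_sup.1 (hγVc x)
  have hAd : Ac (γc x - x) = i • (γc x - x) := by rw [map_sub, ← hγAc, hAx, map_smul, smul_sub]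
  have hcap : ∀ z ∈ V₁c, z ∈ V₂c → z = 0 := fun z hz₁ hz₂ =>
    hnd₁c z hz₁ fun y hy => by rw [hQcs]; exact horthc y hy z hz₂
  have hAv : Ac v₁ = i • v₁ ∧ Ac v₂ = i • v₂ := by
    have hsum : (Ac v₁ - i • v₁) + (Ac v₂ - i • v₂) = 0 := by
      have := hAd
      rw [← hd, map_add, smul_add] at this
      rw [← sub_eq_zero.2 this]; abel
    have hz₁ : Ac v₁ - i • v₁ ∈ V₁c := V₁c.sub_mem (hA₁c v₁ hv₁) (V₁c.smul_mem i hv₁)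
    have hz₂ : Ac v₁ - i • v₁ ∈ V₂c := by
      have : Ac v₁ - i • v₁ = -(Ac v₂ - i • v₂) := eq_neg_of_add_eq_zero_left hsum
      rw [this]; exact V₂c.neg_mem (V₂c.sub_mem (hA₂c v₂ hv₂) (V₂c.smul_mem i hv₂))
    have h₁ : Ac v₁ - i • v₁ = 0 := hcap _ hz₁ hz₂
    have h₂ : Ac v₂ - i • v₂ = 0 := by rw [h₁, zero_add] at hsum; exact hsum
    exact ⟨sub_eq_zero.1 h₁, sub_eq_zero.1 h₂⟩
  obtain ⟨α, hα⟩ := exists_smul_of_eigen_of_plane haQc V₁c hdim₁c hnd₁c hi hℓp₁ hℓp0 hAℓp hv₁ hAv.1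
  obtain ⟨β, hβ⟩ := exists_smul_of_eigen_of_plane haQc V₂c hdim₂c hnd₂c hi hℓm₂ hℓm0 hAℓm hv₂ hAv.2
  have hγx : γc x = x + α • ℓp + β • ℓm := by rw [← hα, ← hβ, add_assoc, hd]; abel
  -- test against `B ℓm ∈ V₁c`: `γ (B ℓm) = A (B ℓm) = −i B ℓm`
  have hℓmB : Qc ℓm (Bc ℓm) = 0 := by rw [hQcs]; exact horthc _ hBℓm₁ _ hℓm₂
  have hℓpB : Qc ℓp (Bc ℓp) = 0 := horthc _ hℓp₁ _ hBℓp₂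
  have hα0 : α = 0 := by
    have h := hγQc x (Bc ℓm)
    have e1 : Qc (γc x) (γc (Bc ℓm)) = (-i) * (α * Qc ℓp (Bc ℓm)) := by
      rw [hγx, hγ₁c _ hBℓm₁, hABℓm]
      simp only [map_add, map_smul, LinearMap.add_apply, LinearMap.smul_apply, smul_eq_mul, hxm, hℓmB]
      ring
    rw [e1, hxm] at h
    rcases mul_eq_zero.1 h with h' | h'
    · exact absurd h' (neg_ne_zero.2 hi0)
    · exact (mul_eq_zero.1 h').resolve_right hpair
  -- test against `B ℓp ∈ V₂c`: `γ (B ℓp) = −A (B ℓp) = i B ℓp`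
  have hβ0 : β = 0 := by
    have h := hγQc x (Bc ℓp)
    have e2 : Qc (γc x) (γc (Bc ℓp)) = i * (β * Qc ℓm (Bc ℓp)) := by
      rw [hγx, hα0, hγ₂c _ hBℓp₂, hABℓp]
      simp only [map_add, map_smul, map_neg, map_zero, LinearMap.add_apply, LinearMap.smul_apply, LinearMap.zero_apply,
        smul_eq_mul, hxp, zero_smul]
      ring
    rw [e2, hxp] at h
    rcases mul_eq_zero.1 h with h' | h'
    · exact absurd h' hi0
    · exact (mul_eq_zero.1 h').resolve_right hpair'
  rw [hγx, hα0, hβ0, zero_smul, zero_smul, add_zero, add_zero]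

end Recognition

end Summit.HodgeConjecture.HodgeConjecture.Theorems.Q8BireflectionRecognition

end
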